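import Mathlib
import HarnessLib
import Literature.Analysis.PDE.DivFormStrongMaximumPrinciple
import Literature.Analysis.FunctionSpaces.PoincareWirtingerConvex
import Summits.NavierStokesRegularity.NavierStokesRegularity.Theorems.PoloidalWindowDoorPoloidalWindowRigidityDivFormLogBMO
import Summits.NavierStokesRegularity.NavierStokesRegularity.Theorems.PoloidalWindowDoorPoloidalWindowRigidityDivFormLocalCaccioppoli

/-!
# Route `PoloidalWindowDoor`, crux K2 (stmt-NavierStokesRegularity-19708) — LOCAL logarithmic oscillation estimate for
# `div(a∇u) = 0` on an open set `U` (towards `divFormStrongMaximumPrinciple_holds`, GT 8.19, via an interior Harnack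
# inequality)

Local twin of the gradient half of `…DivFormLogBMO` (seat ns-poloidal-K2-p3): for a `C¹` function `u ≥ 1` solving
`div(a∇u) = 0` weakly against test functions with `tsupport η ⊆ U` (hypothesis of
`Literature.Analysis.PDE.divFormStrongMaximumPrinciple`), on balls `B(x₀,r)` with `B̄(x₀,2r) ⊆ U`:

* `gradLog_estimate_local` — `λ ∫ χ² ‖Du‖²/u² ≤ 4nΛ ∫ ‖Dχ‖²` for cutoffs with `tsupport χ ⊆ U` (Moser 1961 §5);
* `lintegral_ball_gradLog_sq_le_local` — `∫⁻_{B(x₀,r)} ‖D log u‖ₑ² ≤ (4nΛC₀²2ⁿ/λ) r⁻² |B(x₀,r)|`;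
* `lintegral_ball_logOsc_sq_le_local` — `∫⁻_{B(x₀,r)} ‖log u − (log u)_B‖ₑ² ≤ (16·4ⁿ nΛC₀²/λ) |B(x₀,r)|`
  (Poincaré–Wirtinger, tree `PoincareWirtingerConvex`);
* `measure_ball_logOsc_gt_le_local` — the weak-`L¹` consequence `|{t < |log u − (log u)_B|} ∩ B| ≤ ((K+1)/t)|B|`,
  which is hypothesis (A) of the Bombieri–Giusti lemma (sequel) — the local replacement for the global `BMO` +
  John–Nirenberg crossover of `…DivFormCrossover`, which does not localise.

Proofs of the first two copied from the siblings with the hypothesis localised; helpers (`contDiff_log`,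
`norm_fderiv_log_sq`, cutoffs) imported.  Seat ns-in-ser-b g5 (cell pub/ns-inputs), `ledger fact claim` #1 on
`Literature.Analysis.PDE.divFormStrongMaximumPrinciple`.

WHAT THIS IS NOT: not yet Harnack / the strong maximum principle; nothing NS-specific, no NS statement is touched.
-/

noncomputable section

open MeasureTheory Set Function Filter Topology Metric Module
open scoped Matrix ENNReal

-- the summit and its single sub-problem share the name (CONVENTIONS §1), as in every Theorems file
set_option linter.dupNamespace false

namespace Summit.NavierStokesRegularity.NavierStokesRegularity.Theorems.PoloidalWindowDoorPoloidalWindowRigidityDivFormLocalLogOsc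

open Summit.NavierStokesRegularity.NavierStokesRegularity.Theorems.PoloidalWindowDoorPoloidalWindowRigidityDivFormCaccioppoli
open Summit.NavierStokesRegularity.NavierStokesRegularity.Theorems.PoloidalWindowDoorPoloidalWindowRigidityDivFormCaccioppoliPowers
open Summit.NavierStokesRegularity.NavierStokesRegularity.Theorems.PoloidalWindowDoorPoloidalWindowRigidityDivFormLogBMO
open Summit.NavierStokesRegularity.NavierStokesRegularity.Theorems.PoloidalWindowDoorPoloidalWindowRigidityDivFormLocalCaccioppoli
open Literature.Analysis.FunctionSpaces

variable {n : ℕ} {a : EuclideanSpace ℝ (Fin n) → Matrix (Fin n) (Fin n) ℝ} {lam Λ : ℝ}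
  {u : EuclideanSpace ℝ (Fin n) → ℝ} {U : Set (EuclideanSpace ℝ (Fin n))}

/-! ### The logarithmic Caccioppoli inequality in gradient-norm form, local -/

/-- `λ Σᵢ (∂ᵢu)² ≤ Du·aDu` and `Dχ·aDχ ≤ nΛ ‖Dχ‖²` turn the logarithmic Caccioppoli inequality into
**`λ ∫ χ² ‖D u‖²/u² ≤ 4 n Λ ∫ ‖Dχ‖²`** — the `BMO` input of M2 (`‖D u‖/u = ‖D log u‖`). -/
theorem gradLog_estimate_local (hsymm : ∀ y, (a y).IsSymm) (hlam : 0 < lam)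
    (hmeas : ∀ i j, Measurable fun y => a y i j)
    (hell : ∀ y (ξ : Fin n → ℝ), lam * (ξ ⬝ᵥ ξ) ≤ ξ ⬝ᵥ (a y *ᵥ ξ)) (hbd : ∀ y i j, |a y i j| ≤ Λ)
    (hu : ContDiff ℝ 1 u) (hu1 : ∀ y, 1 ≤ u y)
    (hweak : ∀ η : EuclideanSpace ℝ (Fin n) → ℝ, ContDiff ℝ 1 η → HasCompactSupport η → tsupport η ⊆ U →
      ∫ y, ∑ i, ∑ j, a y i j * fderiv ℝ u y (EuclideanSpace.single i 1) *
        fderiv ℝ η y (EuclideanSpace.single j 1) = 0)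
    {χ : EuclideanSpace ℝ (Fin n) → ℝ} (hχ : ContDiff ℝ 1 χ) (hχc : HasCompactSupport χ)
    (hχU : tsupport χ ⊆ U) :
    lam * ∫ y, χ y ^ 2 * (u y ^ 2)⁻¹ * ‖fderiv ℝ u y‖ ^ 2 ≤
      4 * (n * Λ) * ∫ y, ‖fderiv ℝ χ y‖ ^ 2 := by
  have hupos : ∀ y, 0 < u y := fun y => lt_of_lt_of_le one_pos (hu1 y)
  have h := caccioppoli_log_local hsymm hlam hmeas hell hbd hu hu1 hweak hχ hχc hχU
  have hcu := continuous_fderiv_single hu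
  have hcχ := continuous_fderiv_single hχ
  -- continuity of the two norm integrands, compact support
  have hnu : Continuous fun y => ‖fderiv ℝ u y‖ ^ 2 := ((hu.continuous_fderiv one_ne_zero).norm).pow 2
  have hnχ : Continuous fun y => ‖fderiv ℝ χ y‖ ^ 2 := ((hχ.continuous_fderiv one_ne_zero).norm).pow 2
  have hinvu : Continuous fun y => (u y ^ 2)⁻¹ :=
    ((hu.continuous.pow 2).inv₀ fun y => (pow_pos (hupos y) 2).ne')
  have hIl : Integrable fun y => χ y ^ 2 * (u y ^ 2)⁻¹ * ‖fderiv ℝ u y‖ ^ 2 := by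
    have hc : Continuous fun y => χ y ^ 2 * (u y ^ 2)⁻¹ * ‖fderiv ℝ u y‖ ^ 2 :=
      ((hχ.continuous.pow 2).mul hinvu).mul hnu
    refine hc.integrable_of_hasCompactSupport ?_
    exact ((hasCompactSupport_testFun (u := u) (g := fun s => (s ^ 2)⁻¹) hχc).mul_right)
  have hIr : Integrable fun y => ‖fderiv ℝ χ y‖ ^ 2 := by
    refine hnχ.integrable_of_hasCompactSupport ?_
    exact (hχc.fderiv (𝕜 := ℝ)).norm.comp_left (g := fun s : ℝ => s ^ 2) (by simp)
  -- lower bound on the left integrand, upper bound on the right integrand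
  have hle_l : ∀ y, lam * (χ y ^ 2 * (u y ^ 2)⁻¹ * ‖fderiv ℝ u y‖ ^ 2) ≤
      χ y ^ 2 * (u y ^ 2)⁻¹ *
        ((fun i => fderiv ℝ u y (EuclideanSpace.single i 1)) ⬝ᵥ
          (a y *ᵥ fun i => fderiv ℝ u y (EuclideanSpace.single i 1))) := by
    intro y
    have hq := quadForm_lower hell y (fun i => fderiv ℝ u y (EuclideanSpace.single i 1))
    rw [sum_fderiv_single_sq] at hq
    have hw : 0 ≤ χ y ^ 2 * (u y ^ 2)⁻¹ := by positivity
    nlinarith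
  have hle_r : ∀ y, ((fun j => fderiv ℝ χ y (EuclideanSpace.single j 1)) ⬝ᵥ
          (a y *ᵥ fun j => fderiv ℝ χ y (EuclideanSpace.single j 1))) ≤ n * Λ * ‖fderiv ℝ χ y‖ ^ 2 := by
    intro y
    have hq := quadForm_upper hbd y (fun j => fderiv ℝ χ y (EuclideanSpace.single j 1))
    rwa [sum_fderiv_single_sq] at hq
  -- integrability of the coefficient-form integrands (from the Caccioppoli file's lemmas)
  have hIql : Integrable fun y => χ y ^ 2 * (u y ^ 2)⁻¹ *
      ((fun i => fderiv ℝ u y (EuclideanSpace.single i 1)) ⬝ᵥ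
        (a y *ᵥ fun i => fderiv ℝ u y (EuclideanSpace.single i 1))) := by
    have h' := integrable_mul_of_le_continuous (n := n)
      (m := fun y => (fun i => fderiv ℝ u y (EuclideanSpace.single i 1)) ⬝ᵥ
        (a y *ᵥ fun i => fderiv ℝ u y (EuclideanSpace.single i 1)))
      (M := fun y => n * Λ * (∑ i, fderiv ℝ u y (EuclideanSpace.single i 1) ^ 2 +
        ∑ j, fderiv ℝ u y (EuclideanSpace.single j 1) ^ 2) / 2)
      (φ := fun y => χ y ^ 2 * (u y ^ 2)⁻¹)
      (measurable_dotProduct_mulVec hmeas hcu hcu) (by fun_prop)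
      (fun y => abs_dotProduct_mulVec_le hsymm hlam hell hbd y _ _) ((hχ.continuous.pow 2).mul hinvu)
      (hasCompactSupport_testFun (u := u) (g := fun s => (s ^ 2)⁻¹) hχc)
    exact h'.congr (Eventually.of_forall fun y => by ring)
  have hIqr : Integrable fun y => ((fun j => fderiv ℝ χ y (EuclideanSpace.single j 1)) ⬝ᵥ
      (a y *ᵥ fun j => fderiv ℝ χ y (EuclideanSpace.single j 1))) := by
    refine (hIr.const_mul (n * Λ)).mono' (measurable_dotProduct_mulVec hmeas hcχ hcχ).aestronglyMeasurable
      (Eventually.of_forall fun y => ?_)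
    have hq0 : 0 ≤ ((fun j => fderiv ℝ χ y (EuclideanSpace.single j 1)) ⬝ᵥ
        (a y *ᵥ fun j => fderiv ℝ χ y (EuclideanSpace.single j 1))) :=
      (mul_nonneg hlam.le (Finset.sum_nonneg fun i _ => sq_nonneg _)).trans (quadForm_lower hell y _)
    rw [Real.norm_eq_abs, abs_of_nonneg hq0]
    exact hle_r y
  calc lam * ∫ y, χ y ^ 2 * (u y ^ 2)⁻¹ * ‖fderiv ℝ u y‖ ^ 2
      = ∫ y, lam * (χ y ^ 2 * (u y ^ 2)⁻¹ * ‖fderiv ℝ u y‖ ^ 2) := (integral_const_mul _ _).symm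
    _ ≤ ∫ y, χ y ^ 2 * (u y ^ 2)⁻¹ *
          ((fun i => fderiv ℝ u y (EuclideanSpace.single i 1)) ⬝ᵥ
            (a y *ᵥ fun i => fderiv ℝ u y (EuclideanSpace.single i 1))) :=
        integral_mono (hIl.const_mul lam) hIql hle_l
    _ ≤ 4 * ∫ y, ((fun j => fderiv ℝ χ y (EuclideanSpace.single j 1)) ⬝ᵥ
          (a y *ᵥ fun j => fderiv ℝ χ y (EuclideanSpace.single j 1))) := h
    _ ≤ 4 * ∫ y, n * Λ * ‖fderiv ℝ χ y‖ ^ 2 :=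
        mul_le_mul_of_nonneg_left (integral_mono hIqr (hIr.const_mul _) hle_r) (by norm_num)
    _ = 4 * (n * Λ) * ∫ y, ‖fderiv ℝ χ y‖ ^ 2 := by rw [integral_const_mul]; ring


/-! ### The gradient of `log u` on a ball, local form -/

/-- **The gradient of `log u` on a ball**: `∫⁻_{B(x₀,r)} ‖D log u‖ₑ² ≤ (4nΛC₀²2ⁿ/λ) · r⁻² · |B(x₀,r)|`, for a cutoff
constant `C₀` as in `exists_ball_cutoff`. -/
theorem lintegral_ball_gradLog_sq_le_local (hsymm : ∀ y, (a y).IsSymm) (hlam : 0 < lam)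
    (hmeas : ∀ i j, Measurable fun y => a y i j)
    (hell : ∀ y (ξ : Fin n → ℝ), lam * (ξ ⬝ᵥ ξ) ≤ ξ ⬝ᵥ (a y *ᵥ ξ)) (hbd : ∀ y i j, |a y i j| ≤ Λ)
    (hu : ContDiff ℝ 1 u) (hu1 : ∀ y, 1 ≤ u y)
    (hweak : ∀ η : EuclideanSpace ℝ (Fin n) → ℝ, ContDiff ℝ 1 η → HasCompactSupport η → tsupport η ⊆ U →
      ∫ y, ∑ i, ∑ j, a y i j * fderiv ℝ u y (EuclideanSpace.single i 1) *
        fderiv ℝ η y (EuclideanSpace.single j 1) = 0)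
    {C₀ : ℝ} {x₀ : EuclideanSpace ℝ (Fin n)} {r : ℝ} (hr : 0 < r)
    {χ : EuclideanSpace ℝ (Fin n) → ℝ} (hχ : ContDiff ℝ 1 χ) (hχc : HasCompactSupport χ) (hχU : tsupport χ ⊆ U)
    (hχ1 : ∀ x ∈ ball x₀ r, χ x = 1) (hχ0 : ∀ x, x ∉ ball x₀ (2 * r) → χ x = 0)
    (hχD : ∀ x, ‖fderiv ℝ χ x‖ ≤ C₀ / r) :
    ∫⁻ y in ball x₀ r, ‖fderiv ℝ (fun y => Real.log (u y)) y‖ₑ ^ 2 ≤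
      ENNReal.ofReal (4 * (n * Λ) * C₀ ^ 2 * 2 ^ n / lam / r ^ 2) * volume (ball x₀ r) := by
  have hupos : ∀ y, 0 < u y := fun y => lt_of_lt_of_le one_pos (hu1 y)
  have hnΛ : 0 ≤ (n : ℝ) * Λ := by
    rcases Nat.eq_zero_or_pos n with hn | hn
    · simp [hn]
    · exact mul_nonneg (Nat.cast_nonneg n) ((abs_nonneg _).trans (hbd x₀ ⟨0, hn⟩ ⟨0, hn⟩))
  -- (1) the logarithmic Caccioppoli inequality with this cutoff
  have h1 := gradLog_estimate_local hsymm hlam hmeas hell hbd hu hu1 hweak hχ hχc hχU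
  -- (2) the cutoff gradient: `∫ ‖Dχ‖² ≤ (C₀/r)² |B(x₀, 2r)|`
  have hDχ_out : ∀ x, x ∉ closedBall x₀ (2 * r) → fderiv ℝ χ x = 0 := by
    intro x hx
    have hopen : IsOpen (closedBall x₀ (2 * r))ᶜ := isClosed_closedBall.isOpen_compl
    have hev : χ =ᶠ[𝓝 x] fun _ => 0 := by
      filter_upwards [hopen.mem_nhds hx] with z hz
      exact hχ0 z fun hz' => hz (ball_subset_closedBall hz')
    rw [hev.fderiv_eq, fderiv_const_apply]
  have hint_Dχ : ∫ y, ‖fderiv ℝ χ y‖ ^ 2 ≤ (C₀ / r) ^ 2 * (volume (closedBall x₀ (2 * r))).toReal := by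
    have hcont : Continuous fun y => ‖fderiv ℝ χ y‖ ^ 2 := ((hχ.continuous_fderiv one_ne_zero).norm).pow 2
    have heq : ∫ y, ‖fderiv ℝ χ y‖ ^ 2 = ∫ y in closedBall x₀ (2 * r), ‖fderiv ℝ χ y‖ ^ 2 := by
      refine (setIntegral_eq_integral_of_forall_compl_eq_zero fun y hy => ?_).symm
      rw [hDχ_out y hy, norm_zero, zero_pow two_ne_zero]
    rw [heq]
    calc ∫ y in closedBall x₀ (2 * r), ‖fderiv ℝ χ y‖ ^ 2
        ≤ ∫ y in closedBall x₀ (2 * r), (C₀ / r) ^ 2 := by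
          refine setIntegral_mono_on (hcont.continuousOn.integrableOn_compact (isCompact_closedBall _ _))
            (by simp [measure_closedBall_lt_top]) measurableSet_closedBall fun y _ => ?_
          exact pow_le_pow_left₀ (norm_nonneg _) (hχD y) 2
      _ = (C₀ / r) ^ 2 * (volume (closedBall x₀ (2 * r))).toReal := by
          rw [setIntegral_const, smul_eq_mul, mul_comm]; rfl
  -- (3) volumes: `|B̄(x₀,2r)| = 2ⁿ |B(x₀,r)|`
  have hvol : volume (closedBall x₀ (2 * r)) = ENNReal.ofReal (2 ^ n) * volume (ball x₀ r) := by
    rcases Nat.eq_zero_or_pos n with hn | hn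
    · subst hn
      have h0 : ∀ s : Set (EuclideanSpace ℝ (Fin 0)), s.Nonempty → s = univ := fun s hs => by
        obtain ⟨p, hp⟩ := hs; exact eq_univ_of_forall fun q => by rwa [Subsingleton.elim q p]
      rw [h0 _ ⟨x₀, mem_closedBall_self (by positivity)⟩, h0 _ ⟨x₀, mem_ball_self hr⟩]
      simp
    · haveI : Nonempty (Fin n) := ⟨⟨0, hn⟩⟩
      rw [Measure.addHaar_closedBall_eq_addHaar_ball, Measure.addHaar_ball_of_pos _ _ (by positivity : 0 < 2 * r),
        Measure.addHaar_ball_of_pos _ _ hr, ← mul_assoc, ← ENNReal.ofReal_mul (by positivity), mul_pow,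
        finrank_euclideanSpace, Fintype.card_fin]
  -- (4) the left side: on the ball `χ = 1` and `‖D log u‖² = ‖Du‖²/u²`
  have hcontL : Continuous fun y => (u y ^ 2)⁻¹ * ‖fderiv ℝ u y‖ ^ 2 :=
    ((hu.continuous.pow 2).inv₀ fun y => (pow_pos (hupos y) 2).ne').mul
      (((hu.continuous_fderiv one_ne_zero).norm).pow 2)
  have hinvu : Continuous fun y => (u y ^ 2)⁻¹ := (hu.continuous.pow 2).inv₀ fun y => (pow_pos (hupos y) 2).ne'
  have hnu : Continuous fun y => ‖fderiv ℝ u y‖ ^ 2 := ((hu.continuous_fderiv one_ne_zero).norm).pow 2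
  have hIfull : Integrable fun y => χ y ^ 2 * (u y ^ 2)⁻¹ * ‖fderiv ℝ u y‖ ^ 2 := by
    have hc : Continuous fun y => χ y ^ 2 * (u y ^ 2)⁻¹ * ‖fderiv ℝ u y‖ ^ 2 :=
      ((hχ.continuous.pow 2).mul hinvu).mul hnu
    exact hc.integrable_of_hasCompactSupport
      ((hasCompactSupport_testFun (u := u) (g := fun s => (s ^ 2)⁻¹) hχc).mul_right)
  have hball : ∫ y in ball x₀ r, (u y ^ 2)⁻¹ * ‖fderiv ℝ u y‖ ^ 2 ≤
      ∫ y, χ y ^ 2 * (u y ^ 2)⁻¹ * ‖fderiv ℝ u y‖ ^ 2 := by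
    calc ∫ y in ball x₀ r, (u y ^ 2)⁻¹ * ‖fderiv ℝ u y‖ ^ 2
        = ∫ y in ball x₀ r, χ y ^ 2 * (u y ^ 2)⁻¹ * ‖fderiv ℝ u y‖ ^ 2 :=
          setIntegral_congr_fun measurableSet_ball fun y hy => by rw [hχ1 y hy]; ring
      _ ≤ ∫ y, χ y ^ 2 * (u y ^ 2)⁻¹ * ‖fderiv ℝ u y‖ ^ 2 :=
          setIntegral_le_integral hIfull (Eventually.of_forall fun y => by positivity)
  -- assemble in `ℝ`
  have hreal : ∫ y in ball x₀ r, ‖fderiv ℝ (fun y => Real.log (u y)) y‖ ^ 2 ≤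
      4 * (n * Λ) * C₀ ^ 2 * 2 ^ n / lam / r ^ 2 * (volume (ball x₀ r)).toReal := by
    have hv : (volume (closedBall x₀ (2 * r))).toReal = 2 ^ n * (volume (ball x₀ r)).toReal := by
      rw [hvol, ENNReal.toReal_mul, ENNReal.toReal_ofReal (by positivity)]
    have hL : ∫ y in ball x₀ r, ‖fderiv ℝ (fun y => Real.log (u y)) y‖ ^ 2 =
        ∫ y in ball x₀ r, (u y ^ 2)⁻¹ * ‖fderiv ℝ u y‖ ^ 2 :=
      setIntegral_congr_fun measurableSet_ball fun y _ => norm_fderiv_log_sq hu hu1 y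
    rw [hL]
    have h2 : lam * ∫ y in ball x₀ r, (u y ^ 2)⁻¹ * ‖fderiv ℝ u y‖ ^ 2 ≤
        4 * (n * Λ) * ((C₀ / r) ^ 2 * (2 ^ n * (volume (ball x₀ r)).toReal)) := by
      calc lam * ∫ y in ball x₀ r, (u y ^ 2)⁻¹ * ‖fderiv ℝ u y‖ ^ 2
          ≤ lam * ∫ y, χ y ^ 2 * (u y ^ 2)⁻¹ * ‖fderiv ℝ u y‖ ^ 2 := mul_le_mul_of_nonneg_left hball hlam.le
        _ ≤ 4 * (n * Λ) * ∫ y, ‖fderiv ℝ χ y‖ ^ 2 := h1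
        _ ≤ 4 * (n * Λ) * ((C₀ / r) ^ 2 * (2 ^ n * (volume (ball x₀ r)).toReal)) := by
            rw [← hv]; exact mul_le_mul_of_nonneg_left hint_Dχ (by positivity)
    rw [← le_div_iff₀' hlam] at h2
    refine h2.trans (le_of_eq ?_)
    field_simp
  -- convert to `ℝ≥0∞`
  have hnn : 0 ≤ᵐ[volume.restrict (ball x₀ r)] fun y => ‖fderiv ℝ (fun y => Real.log (u y)) y‖ ^ 2 :=
    Eventually.of_forall fun y => by positivity
  have hIball : IntegrableOn (fun y => ‖fderiv ℝ (fun y => Real.log (u y)) y‖ ^ 2) (ball x₀ r) :=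
    ((((contDiff_log hu hu1).continuous_fderiv one_ne_zero).norm).pow 2).continuousOn.integrableOn_compact
      (isCompact_closedBall x₀ r) |>.mono_set ball_subset_closedBall
  calc ∫⁻ y in ball x₀ r, ‖fderiv ℝ (fun y => Real.log (u y)) y‖ₑ ^ 2
      = ∫⁻ y in ball x₀ r, ENNReal.ofReal (‖fderiv ℝ (fun y => Real.log (u y)) y‖ ^ 2) := by
        refine lintegral_congr fun y => ?_
        rw [← ofReal_norm, ← ENNReal.ofReal_pow (norm_nonneg _)]
    _ = ENNReal.ofReal (∫ y in ball x₀ r, ‖fderiv ℝ (fun y => Real.log (u y)) y‖ ^ 2) :=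
        (ofReal_integral_eq_lintegral_ofReal hIball hnn).symm
    _ ≤ ENNReal.ofReal (4 * (n * Λ) * C₀ ^ 2 * 2 ^ n / lam / r ^ 2 * (volume (ball x₀ r)).toReal) :=
        ENNReal.ofReal_le_ofReal hreal
    _ = ENNReal.ofReal (4 * (n * Λ) * C₀ ^ 2 * 2 ^ n / lam / r ^ 2) * volume (ball x₀ r) := by
        rw [ENNReal.ofReal_mul (by positivity), ENNReal.ofReal_toReal measure_ball_lt_top.ne]

/-! ### The logarithmic oscillation on a ball -/

/-- **`L²` oscillation of `log u` over a ball** (Moser 1961 §5, localised): if `B̄(x₀,2r) ⊆ U` and `C₀` is a cutoff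
constant as in `…DivFormLogBMO.exists_ball_cutoff`, then
`∫⁻_{B(x₀,r)} ‖log u − (log u)_{B(x₀,r)}‖ₑ² ≤ (16 · 4ⁿ · nΛ C₀² / λ) · |B(x₀,r)|`
(logarithmic Caccioppoli + the Poincaré–Wirtinger inequality of the tree, `PoincareWirtingerConvex`). -/
theorem lintegral_ball_logOsc_sq_le_local (hsymm : ∀ y, (a y).IsSymm) (hlam : 0 < lam)
    (hmeas : ∀ i j, Measurable fun y => a y i j)
    (hell : ∀ y (ξ : Fin n → ℝ), lam * (ξ ⬝ᵥ ξ) ≤ ξ ⬝ᵥ (a y *ᵥ ξ)) (hbd : ∀ y i j, |a y i j| ≤ Λ)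
    (hu : ContDiff ℝ 1 u) (hu1 : ∀ y, 1 ≤ u y)
    (hweak : ∀ η : EuclideanSpace ℝ (Fin n) → ℝ, ContDiff ℝ 1 η → HasCompactSupport η → tsupport η ⊆ U →
      ∫ y, ∑ i, ∑ j, a y i j * fderiv ℝ u y (EuclideanSpace.single i 1) *
        fderiv ℝ η y (EuclideanSpace.single j 1) = 0)
    {C₀ : ℝ}
    (hcut : ∀ (x₀ : EuclideanSpace ℝ (Fin n)) (r : ℝ), 0 < r →
      ∃ χ : EuclideanSpace ℝ (Fin n) → ℝ, ContDiff ℝ 1 χ ∧ HasCompactSupport χ ∧ (∀ x, 0 ≤ χ x ∧ χ x ≤ 1) ∧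
        (∀ x ∈ ball x₀ r, χ x = 1) ∧ (∀ x, x ∉ ball x₀ (2 * r) → χ x = 0) ∧ ∀ x, ‖fderiv ℝ χ x‖ ≤ C₀ / r)
    (x₀ : EuclideanSpace ℝ (Fin n)) {r : ℝ} (hr : 0 < r) (hU : closedBall x₀ (2 * r) ⊆ U) :
    ∫⁻ y in ball x₀ r, ‖Real.log (u y) - ⨍ z in ball x₀ r, Real.log (u z)‖ₑ ^ 2 ∂volume ≤
      ENNReal.ofReal (16 * 4 ^ n * (n * Λ) * C₀ ^ 2 / lam) * volume (ball x₀ r) := by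
  obtain ⟨χ, hχ, hχc, hχ01, hχ1, hχ0, hχD⟩ := hcut x₀ r hr
  have hχU : tsupport χ ⊆ U := by
    refine (closure_minimal (fun x hx => ?_) isClosed_closedBall).trans hU
    by_contra h
    exact hx (hχ0 x fun hb => h (ball_subset_closedBall hb))
  set f : EuclideanSpace ℝ (Fin n) → ℝ := fun y => Real.log (u y) with hf
  have hfC : ContDiff ℝ 1 f := contDiff_log hu hu1
  have hB0 : volume (ball x₀ r) ≠ 0 := (measure_ball_pos volume x₀ hr).ne'
  have hBt : volume (ball x₀ r) ≠ ∞ := measure_ball_lt_top.ne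
  have hnΛ : 0 ≤ (n : ℝ) * Λ := by
    rcases Nat.eq_zero_or_pos n with hn | hn
    · simp [hn]
    · exact mul_nonneg (Nat.cast_nonneg n) ((abs_nonneg _).trans (hbd x₀ ⟨0, hn⟩ ⟨0, hn⟩))
  -- Poincaré–Wirtinger on the ball (diameter `2r`)
  have hP := lintegral_enorm_sub_setAverage_sq_le (μ := (volume : Measure (EuclideanSpace ℝ (Fin n)))) hfC
    (convex_ball x₀ r) measurableSet_ball hB0 hBt
    ((hfC.continuous.continuousOn.integrableOn_compact (isCompact_closedBall x₀ r)).mono_set ball_subset_closedBall)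
    (D := 2 * r) (fun y hy z hz => by
      rw [← dist_eq_norm]
      calc dist y z ≤ dist y x₀ + dist z x₀ := dist_triangle_right _ _ _
        _ ≤ 2 * r := by rw [mem_ball] at hy hz; linarith)
  rw [finrank_euclideanSpace, Fintype.card_fin] at hP
  -- the gradient bound
  have hG := lintegral_ball_gradLog_sq_le_local hsymm hlam hmeas hell hbd hu hu1 hweak hr hχ hχc hχU hχ1 hχ0 hχD
  refine hP.trans ?_
  calc ENNReal.ofReal (2 ^ n * (2 * r) ^ 2) * ∫⁻ y in ball x₀ r, ‖fderiv ℝ f y‖ₑ ^ 2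
      ≤ ENNReal.ofReal (2 ^ n * (2 * r) ^ 2) *
          (ENNReal.ofReal (4 * (n * Λ) * C₀ ^ 2 * 2 ^ n / lam / r ^ 2) * volume (ball x₀ r)) := by
        gcongr
    _ = ENNReal.ofReal (16 * 4 ^ n * (n * Λ) * C₀ ^ 2 / lam) * volume (ball x₀ r) := by
        rw [← mul_assoc, ← ENNReal.ofReal_mul (by positivity)]
        congr 2
        rw [show (4 : ℝ) ^ n = 2 ^ n * 2 ^ n by rw [← mul_pow]; norm_num]
        field_simp
        ring

/-- **Weak-`L¹` form of the logarithmic oscillation** (the hypothesis `(A)` of the Bombieri–Giusti lemma): with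
`c = (log u)_{B(x₀,r)}` and `K = 16·4ⁿ·nΛC₀²/λ`, for every `t > 0`,
`|{y ∈ B(x₀,r) : t < |log u(y) − c|}| ≤ ((K + 1)/t) · |B(x₀,r)|` (Chebyshev on the `L²` bound for `t ≥ 1`, the
trivial bound for `t ≤ 1`). -/
theorem measure_ball_logOsc_gt_le_local (hsymm : ∀ y, (a y).IsSymm) (hlam : 0 < lam)
    (hmeas : ∀ i j, Measurable fun y => a y i j)
    (hell : ∀ y (ξ : Fin n → ℝ), lam * (ξ ⬝ᵥ ξ) ≤ ξ ⬝ᵥ (a y *ᵥ ξ)) (hbd : ∀ y i j, |a y i j| ≤ Λ)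
    (hu : ContDiff ℝ 1 u) (hu1 : ∀ y, 1 ≤ u y)
    (hweak : ∀ η : EuclideanSpace ℝ (Fin n) → ℝ, ContDiff ℝ 1 η → HasCompactSupport η → tsupport η ⊆ U →
      ∫ y, ∑ i, ∑ j, a y i j * fderiv ℝ u y (EuclideanSpace.single i 1) *
        fderiv ℝ η y (EuclideanSpace.single j 1) = 0)
    {C₀ : ℝ}
    (hcut : ∀ (x₀ : EuclideanSpace ℝ (Fin n)) (r : ℝ), 0 < r →
      ∃ χ : EuclideanSpace ℝ (Fin n) → ℝ, ContDiff ℝ 1 χ ∧ HasCompactSupport χ ∧ (∀ x, 0 ≤ χ x ∧ χ x ≤ 1) ∧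
        (∀ x ∈ ball x₀ r, χ x = 1) ∧ (∀ x, x ∉ ball x₀ (2 * r) → χ x = 0) ∧ ∀ x, ‖fderiv ℝ χ x‖ ≤ C₀ / r)
    (x₀ : EuclideanSpace ℝ (Fin n)) {r : ℝ} (hr : 0 < r) (hU : closedBall x₀ (2 * r) ⊆ U) {t : ℝ} (ht : 0 < t) :
    volume {y ∈ ball x₀ r | t < |Real.log (u y) - ⨍ z in ball x₀ r, Real.log (u z)|} ≤
      ENNReal.ofReal ((16 * 4 ^ n * (n * Λ) * C₀ ^ 2 / lam + 1) / t) * volume (ball x₀ r) := by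
  set K : ℝ := 16 * 4 ^ n * (n * Λ) * C₀ ^ 2 / lam with hK
  set c : ℝ := ⨍ z in ball x₀ r, Real.log (u z) with hc
  set E : Set (EuclideanSpace ℝ (Fin n)) := {y ∈ ball x₀ r | t < |Real.log (u y) - c|} with hE
  have hnΛ : 0 ≤ (n : ℝ) * Λ := by
    rcases Nat.eq_zero_or_pos n with hn | hn
    · simp [hn]
    · exact mul_nonneg (Nat.cast_nonneg n) ((abs_nonneg _).trans (hbd x₀ ⟨0, hn⟩ ⟨0, hn⟩))
  have hKnn : 0 ≤ K := by rw [hK]; positivity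
  have hEsub : E ⊆ ball x₀ r := fun y hy => hy.1
  -- Chebyshev: `t² |E| ≤ ∫⁻_B osc² ≤ K |B|`
  have hosc := lintegral_ball_logOsc_sq_le_local hsymm hlam hmeas hell hbd hu hu1 hweak hcut x₀ hr hU
  have hcont : Continuous fun y => Real.log (u y) - c := (contDiff_log hu hu1).continuous.sub continuous_const
  have hcheb : ENNReal.ofReal (t ^ 2) * volume E ≤ ENNReal.ofReal K * volume (ball x₀ r) := by
    have hmeasg : AEMeasurable (fun y => ‖Real.log (u y) - c‖ₑ ^ 2) (volume.restrict (ball x₀ r)) :=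
      (hcont.measurable.enorm.pow_const _).aemeasurable
    have h1 := mul_meas_ge_le_lintegral₀ hmeasg (ENNReal.ofReal (t ^ 2))
    have h2 : volume E ≤ (volume.restrict (ball x₀ r)) {y | ENNReal.ofReal (t ^ 2) ≤ ‖Real.log (u y) - c‖ₑ ^ 2} := by
      rw [Measure.restrict_apply' measurableSet_ball]
      refine measure_mono fun y hy => ⟨?_, hy.1⟩
      have hlt : t < |Real.log (u y) - c| := hy.2
      show ENNReal.ofReal (t ^ 2) ≤ ‖Real.log (u y) - c‖ₑ ^ 2
      rw [Real.enorm_eq_ofReal_abs, ← ENNReal.ofReal_pow (abs_nonneg _)]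
      exact ENNReal.ofReal_le_ofReal (pow_le_pow_left₀ ht.le hlt.le 2)
    calc ENNReal.ofReal (t ^ 2) * volume E
        ≤ ENNReal.ofReal (t ^ 2) *
            (volume.restrict (ball x₀ r)) {y | ENNReal.ofReal (t ^ 2) ≤ ‖Real.log (u y) - c‖ₑ ^ 2} :=
          mul_le_mul' le_rfl h2
      _ ≤ ∫⁻ y in ball x₀ r, ‖Real.log (u y) - c‖ₑ ^ 2 := h1
      _ ≤ ENNReal.ofReal K * volume (ball x₀ r) := hosc
  -- the two cases
  rcases le_or_gt 1 t with h1t | ht1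
  · -- `t ≥ 1`: `|E| ≤ K|B|/t² ≤ (K+1)|B|/t`
    have ht2 : 0 < t ^ 2 := by positivity
    have hE1 : volume E ≤ ENNReal.ofReal (K / t ^ 2) * volume (ball x₀ r) := by
      have hne : ENNReal.ofReal (t ^ 2) ≠ 0 := (ENNReal.ofReal_pos.2 ht2).ne'
      calc volume E = (ENNReal.ofReal (t ^ 2))⁻¹ * (ENNReal.ofReal (t ^ 2) * volume E) := by
            rw [← mul_assoc, ENNReal.inv_mul_cancel hne ENNReal.ofReal_ne_top, one_mul]
        _ ≤ (ENNReal.ofReal (t ^ 2))⁻¹ * (ENNReal.ofReal K * volume (ball x₀ r)) := mul_le_mul' le_rfl hcheb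
        _ = ENNReal.ofReal (K / t ^ 2) * volume (ball x₀ r) := by
            rw [← mul_assoc, ← ENNReal.ofReal_inv_of_pos ht2, ← ENNReal.ofReal_mul (inv_nonneg.2 ht2.le),
              inv_mul_eq_div]
    refine hE1.trans (mul_le_mul' (ENNReal.ofReal_le_ofReal ?_) le_rfl)
    rw [div_le_div_iff₀ ht2 ht]
    have hKt : 0 ≤ K * t * (t - 1) := mul_nonneg (mul_nonneg hKnn ht.le) (sub_nonneg.2 h1t)
    nlinarith
  · -- `t < 1`: `|E| ≤ |B| ≤ (K+1)|B|/t`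
    calc volume E ≤ volume (ball x₀ r) := measure_mono hEsub
      _ = 1 * volume (ball x₀ r) := (one_mul _).symm
      _ ≤ ENNReal.ofReal ((K + 1) / t) * volume (ball x₀ r) := by
          refine mul_le_mul' ?_ le_rfl
          rw [← ENNReal.ofReal_one]
          refine ENNReal.ofReal_le_ofReal ?_
          rw [le_div_iff₀ ht]
          nlinarith

end Summit.NavierStokesRegularity.NavierStokesRegularity.Theorems.PoloidalWindowDoorPoloidalWindowRigidityDivFormLocalLogOsc

end
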